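/-
Copyright: statement-level skeleton of a published paper (lit-balaban cell, Phase-2 proof seat p25, gen 22). No proof
claims beyond what the kernel checks below.
-/
import Literature.MathematicalPhysics.QuantumFieldTheory.BalabanImbrieJaffe1984to88.BIJ88WalkSplitSupport245
import Literature.MathematicalPhysics.QuantumFieldTheory.BalabanImbrieJaffe1984to88.BIJ88WalkProductCutoffVolFree312

/-!
# `BalabanImbrieJaffe1984to88.BIJ88WalkSplit245Letters` — T. Bałaban, J. Imbrie, A. Jaffe, *Effective action and
cluster properties of the abelian Higgs model*, Commun. Math. Phys. **114** (1988) 257–315 [BalabanImbrieJaffe1988],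
§5.14 p. 310 [PDF 54] (x2 render `lit-balaban-r16/renders/cmp114/original-p054-x2.png`), verbatim: *"We give random
walk expansions for the propagators C^{(k)}_{Λ₁₂^{(k)}}, C^{(k)}_{Λ₁₂^{(k)}}(u_{k+1}) produced in this step. The leading
terms, with only propagators C^{(k)}_{Λ₁₂^{(k)},loc}, C^{(k)}_{Λ₁₂^{(k)},loc}(u_{k+1}), we transform further. The others,
localized in region X, have a factor of e^{−cr(e_k)|X|}. We also consider as remainders any terms whose order in λ
and e is greater than n̄."*, with Sect. 2 p. 264 [PDF 8]: *"Let X be a connected union of r(e_k)-cubes … The local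
part C^{(k)}_{Λ,loc}(u; x₁, x₂) … vanishes for |x₁ − x₂| > ½r(e_k) and is bounded as in (2.41). The operator
C^{(k)}_{Λ,X}(u) depends only on u in X. It vanishes unless both arguments are in X, and is estimated as follows:
|C^{(k)}_{Λ,X}(u; x₁, x₂)| ≦ e^{−cr(e_k)|X|}. (2.46)"* and p. 265: *"Here and elsewhere, |X| refers to the number of
r(e_k)-cubes in X, not the volume of X."* — **THE ANALYTIC LETTERS OF PRINT'S SPLIT (2.45) FOR THE HEAD OF ROW
C2.Claim@312** (p25 gen 22; file W6a, a MEMBER of the row, owner r16, referee ref-5; the head of record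
`BIJ88WalkIneq312RemainderBdry.ineq312_remainder_bdry` and every earlier file UNCHANGED).

Gen 21 reduced the head's locality clause to reach data and per-cube weight sums
(`BIJ88WalkProductCutoffWeighted312.ineq312_remainder_bdry_prodCutoff_of_reach`) and PROVED the reach data of
print's split `C = C_loc + Σ_X C_X` (`BIJ88WalkSplitReach`, `BIJ88WalkSplitSupport245`).  What remained were the
ANALYTIC letters of the pieces: the bracket clauses `hB`, `hBf`, the booking clause `hBzN` (site product cutoffs,
volume-free `ℓ¹` currency) and the clause letters `hloc` (`B′_loc ≤ B_ℓ`), `hwalk` (`B′_X ≤ θ_w·θ^{|X|}`).  Here they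
are DERIVED for the family `none ↦ C_loc`, `some X ↦ C_X` (`X` over the admissible — in print: connected — unions
of `r(e_k)`-cubes, a subtype) from: the typed row (2.46) `BIJ88Sect2Statements.Ineq246` (support clause AND the
entrywise bound `e^{−c·r(e_k)·|X|}`; PROVED in [6]'s setting by p36's `BIJ88Ineq246Walks.ineq246`), an entrywise
bound `E_loc` on `C_loc` (*"bounded as in (2.41)"*; p02's `BIJ88Decay241Walks.abs_cLoc_le_exp`), the finite range of
`C_loc` (p13's `cLoc_eq_zero_of_far` via W4d's `cLoc_ne_zero_near`), `≤ s_c` sites per `r(e_k)`-cube, a `near`-degree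
`≤ D`.  Mechanism (§1): an entrywise bound `E` and a column support of `≤ n` sites give column sums `≤ E·n`, hence
`|⟨C u, w⟩| ≤ ‖w‖_∞·E·n·Σ|u|` and N4's `ℓ¹` booking letter.  Weights `ρ_loc = 1`, `ρ_X = λ^{|X|}`, `λ = e^{−c·r(e_k)/2}`;
letters `B′_loc = E_loc·D·s_c·R₁K_w`, `B′_X = λ^{|X|}·|X|·s_c·R₁K_w` (`K_w = R_∞ + ‖f‖_∞ + 1`), so `B′_X·ρ_X` is the
column-sum letter `e^{−c·r(e_k)|X|}·|X|·s_c·R₁K_w`; the clause letters hold under `e^{−c·r(e_k)/4} ≤ θ` and TWO explicit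
largeness conditions on `c·r(e_k)` (print p. 260: `r(e_k) = |log e_k|^r → ∞`); the per-cube sums of the region
weights (W4b's animal sums on the connected subtype) and the one-call assembly are in `BIJ88WalkIneq312Split245`.

statement-level skeleton of published theorems with citation tags; proofs where landed; nothing here is a claim
about the Yang–Mills mass gap

PDF held: `paper:balaban1988-cmp114-bij-abelian-higgs-effective-action` (journal page = PDF page + 256); p. 310 = PDF
54 (re-read this session from the x2 render), pp. 264–265 = PDF 8–9.

CITATION HEADER (lean-in-tree rule).  lit-balaban cell (HOME `run/shared/lean/pub/lit-balaban/`), Phase 2, seat p25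
gen 22; row **C2.Claim@312** of `HOME/lit-balaban-r16/ROWS-C2-part2.md` (owner r16, referee ref-5; MEMBER).  USED BY
NAME, nothing restated: `BIJ88Sect2Statements.Ineq246` (r18, typed row (2.46)), `BIJ88RandomWalk242.{cLoc, cX, memX,
closure}` (p13), `BIJ88WalkSplitSupport245.cLoc_ne_zero_near` (p25 gen 21 W4d),
`BIJ88WalkProductCutoffVolFree312.{sum_abs_mulVec_le, hBzN_site_of_colsum}` (N4).  The consumer is the one-call
assembly `BIJ88WalkIneq312Split245` (W6b, same seat).

## What is proved (0 `sorry`, standard axioms, no new `Prop` facts; theorems only, no definitions)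

* §1 `colsum_le_of_entry_support`, `abs_mulVec_dotProduct_le_of_colsum`, **`letters_of_colsum`** (the three
  bracket/booking letters of a family from its column sums, common right-hand side `C₁(p)·R₁·K_w`);
* §2 `card_filter_cube_mem_le` (sites over a cube set: `≤ |Y|·s_c`);
* §3 `cube_mem_of_cX_ne_zero`, **`colsum_cX_le`** (`Σ_x|C_X(x,y)| ≤ e^{−c·r(e_k)|X|}·|X|·s_c`), **`colsum_cLoc_le`**
  (`Σ_x|C_loc(x,y)| ≤ E_loc·D·s_c`);
* §4 (private `exp_neg_pow_mul_le`: `e^{−am}·m ≤ e^{−a}`, `a, m ≥ 1`), **`split245_letters`** (the seven clause inputs `hB0`,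
  `hρ`, `hB`, `hBf`, `hBzN`, `hloc`, `hwalk` of the head for the (2.45) family with the weights and letters above).
HONEST SCOPE: (a) the pieces are p13's (2.43)/(2.44) objects over ABSTRACT walk kernels `C_ω`; the bound (2.46) and
the bound on `C_loc` enter as the typed row / an entrywise letter (dischargeable by name in [6]'s setting, not
re-proved here), the lattice geometry (`hblk`, `htri`, `hnear`, `s_c`, `D`, `Δ`) as hypotheses; (b) no expectation,
no cluster expansion, nothing of §5.14 beyond the letters; (c) `K_w` carries `‖f‖_∞` of the source — a field-size
letter of the model of record, as in gen 20–21.  NOT summit progress; NOT continuum; NOT Clay.  Imports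
`BIJ88WalkSplitSupport245`, `BIJ88WalkProductCutoffVolFree312`; modifies nothing.
-/

noncomputable section

namespace Literature.MathematicalPhysics.QuantumFieldTheory.BalabanImbrieJaffe1984to88.BIJ88WalkSplit245Letters

open Classical Matrix Finset
open scoped BigOperators
open BIJ88RandomWalk242
open BIJ88WalkSplitSupport245 (cLoc_ne_zero_near)
open BIJ88WalkProductCutoffVolFree312 (sum_abs_mulVec_le hBzN_site_of_colsum)

/-! ## §1  Entrywise bound and column support ⇒ column sums ⇒ brackets -/

section Generic

variable {S : Type} [Fintype S]

/-- **COLUMN SUMS FROM AN ENTRYWISE BOUND AND A COLUMN SUPPORT**: if `|C_{xy}| ≤ E` and the column `y` is supported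
in `T(y)` with `|T(y)| ≤ n`, then `Σ_x|C_{xy}| ≤ E·n`. [folklore] [cite: BalabanImbrieJaffe1988, (2.46) p.264] -/
theorem colsum_le_of_entry_support (C : Matrix S S ℝ) {E : ℝ} (hE0 : 0 ≤ E) (hE : ∀ x y, |C x y| ≤ E)
    (T : S → Finset S) (hT : ∀ x y, C x y ≠ 0 → x ∈ T y) {n : ℕ} (hn : ∀ y, (T y).card ≤ n) (y : S) :
    ∑ x, |C x y| ≤ E * n := by
  have h1 : ∑ x ∈ T y, |C x y| = ∑ x, |C x y| :=
    Finset.sum_subset (Finset.subset_univ _) fun x _ hx => abs_eq_zero.mpr (not_not.mp fun h => hx (hT x y h))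
  rw [← h1]
  calc ∑ x ∈ T y, |C x y| ≤ ∑ _x ∈ T y, E := Finset.sum_le_sum fun x _ => hE x y
    _ = (T y).card * E := by rw [Finset.sum_const, nsmul_eq_mul]
    _ ≤ n * E := mul_le_mul_of_nonneg_right (by exact_mod_cast hn y) hE0
    _ = E * n := mul_comm _ _

/-- **A BRACKET FROM COLUMN SUMS**: `|⟨C u, w⟩| ≤ ‖w‖_∞·C₁·Σ_y|u_y|` if `Σ_x|C_{xy}| ≤ C₁`. [folklore]
[cite: BalabanImbrieJaffe1988, §5.14 p.310] -/
theorem abs_mulVec_dotProduct_le_of_colsum (C : Matrix S S ℝ) {C₁ : ℝ} (hC : ∀ y, ∑ x, |C x y| ≤ C₁)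
    (u w : S → ℝ) : |(C *ᵥ u) ⬝ᵥ w| ≤ ‖w‖ * (C₁ * ∑ y, |u y|) := by
  have hw : ∀ x, |w x| ≤ ‖w‖ := fun x => by rw [← Real.norm_eq_abs]; exact norm_le_pi_norm w x
  calc |(C *ᵥ u) ⬝ᵥ w| = |∑ x, (C *ᵥ u) x * w x| := rfl
    _ ≤ ∑ x, |(C *ᵥ u) x * w x| := Finset.abs_sum_le_sum_abs _ _
    _ ≤ ∑ x, |(C *ᵥ u) x| * ‖w‖ := Finset.sum_le_sum fun x _ => by
        rw [abs_mul]; exact mul_le_mul_of_nonneg_left (hw x) (abs_nonneg _)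
    _ = ‖w‖ * ∑ x, |(C *ᵥ u) x| := by rw [← Finset.sum_mul, mul_comm]
    _ ≤ ‖w‖ * (C₁ * ∑ y, |u y|) := mul_le_mul_of_nonneg_left (sum_abs_mulVec_le C hC u) (norm_nonneg _)

/-- **THE THREE BRACKET/BOOKING LETTERS OF A FAMILY FROM ITS COLUMN SUMS**: for pieces `C_p` with column sums
`≤ C₁(p)`, directions with `‖u‖_∞ ≤ R_∞`, `Σ|u| ≤ R₁`, a test vector `f` (the source) and site cutoffs at distinct
sites `y_b`: `|⟨C_p u, w⟩|`, `|⟨C_p u, f⟩|` and `Σ_b|(C_p u)(y_b)|` are all `≤ C₁(p)·R₁·(R_∞ + ‖f‖_∞ + 1)` — the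
clause inputs `hB`, `hBf`, `hBzN` of the head with ONE right-hand side. [cite: BalabanImbrieJaffe1988, §5.14 p.310, p.312] -/
theorem letters_of_colsum {P B : Type} (Bs : Finset B) {y : B → S} (hy : Set.InjOn y Bs)
    {Cov : P → Matrix S S ℝ} {C₁ : P → ℝ} (hC0 : ∀ p, 0 ≤ C₁ p) (hC : ∀ p yy, ∑ x, |Cov p x yy| ≤ C₁ p)
    (f : S → ℝ) {Dir : Set (S → ℝ)} {Rinf R1 : ℝ} (hRinf : 0 ≤ Rinf) (hR1 : 0 ≤ R1)
    (hDir : ∀ u ∈ Dir, ‖u‖ ≤ Rinf ∧ ∑ x, |u x| ≤ R1) :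
    (∀ p, ∀ u ∈ Dir, ∀ w ∈ Dir, |(Cov p *ᵥ u) ⬝ᵥ w| ≤ C₁ p * (R1 * (Rinf + ‖f‖ + 1))) ∧
    (∀ p, ∀ u ∈ Dir, |(Cov p *ᵥ u) ⬝ᵥ f| ≤ C₁ p * (R1 * (Rinf + ‖f‖ + 1))) ∧
    (∀ p, ∀ u ∈ Dir, (∑ b ∈ Bs, |(ContinuousLinearMap.proj (y b) : (S → ℝ) →L[ℝ] ℝ) (Cov p *ᵥ u)|)
      ≤ C₁ p * (R1 * (Rinf + ‖f‖ + 1))) := by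
  have hKw : 0 ≤ Rinf + ‖f‖ + 1 := by linarith [norm_nonneg f]
  have hK : ∀ p, ∀ u ∈ Dir, ∀ t : ℝ, 0 ≤ t → t ≤ Rinf + ‖f‖ + 1 →
      t * (C₁ p * ∑ x, |u x|) ≤ C₁ p * (R1 * (Rinf + ‖f‖ + 1)) := by
    intro p u hu t _ ht
    have h1 : C₁ p * ∑ x, |u x| ≤ C₁ p * R1 := mul_le_mul_of_nonneg_left (hDir u hu).2 (hC0 p)
    calc t * (C₁ p * ∑ x, |u x|) ≤ (Rinf + ‖f‖ + 1) * (C₁ p * R1) :=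
          mul_le_mul ht h1 (mul_nonneg (hC0 p) (Finset.sum_nonneg fun _ _ => abs_nonneg _)) hKw
      _ = C₁ p * (R1 * (Rinf + ‖f‖ + 1)) := by ring
  refine ⟨fun p u hu w hw => ?_, fun p u hu => ?_, fun p u hu => ?_⟩
  · exact (abs_mulVec_dotProduct_le_of_colsum (Cov p) (hC p) u w).trans
      (hK p u hu ‖w‖ (norm_nonneg _) (by linarith [(hDir w hw).1, norm_nonneg f]))
  · exact (abs_mulVec_dotProduct_le_of_colsum (Cov p) (hC p) u f).trans
      (hK p u hu ‖f‖ (norm_nonneg _) (by linarith [norm_nonneg f]))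
  · calc _ ≤ C₁ p * R1 := hBzN_site_of_colsum Bs hy hC0 hC (fun u hu => (hDir u hu).2) p u hu
      _ = 1 * (C₁ p * R1) := (one_mul _).symm
      _ ≤ (Rinf + ‖f‖ + 1) * (C₁ p * R1) :=
          mul_le_mul_of_nonneg_right (by linarith [norm_nonneg f]) (mul_nonneg (hC0 p) hR1)
      _ = C₁ p * (R1 * (Rinf + ‖f‖ + 1)) := by ring

end Generic

/-! ## §2  Counting sites over a set of cubes -/

section Count

variable {S K : Type} [Fintype S] [DecidableEq K]

/-- **SITES OVER A CUBE SET**: with at most `s_c` sites per cube, at most `|Y|·s_c` sites have their cube in `Y`.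
[folklore] [cite: BalabanImbrieJaffe1988, Sect. 2 p.265 ("|X| refers to the number of r(e_k)-cubes in X")] -/
theorem card_filter_cube_mem_le (cube : S → K) {sc : ℕ} (hsc : ∀ k, (univ.filter fun x => cube x = k).card ≤ sc)
    (Y : Finset K) : (univ.filter fun x => cube x ∈ Y).card ≤ Y.card * sc := by
  have h : (univ.filter fun x => cube x ∈ Y) = Y.biUnion fun k => univ.filter fun x => cube x = k := by
    ext x
    simp only [Finset.mem_filter, Finset.mem_univ, true_and, Finset.mem_biUnion, exists_eq_right']
  rw [h]
  calc _ ≤ ∑ k ∈ Y, (univ.filter fun x => cube x = k).card := Finset.card_biUnion_le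
    _ ≤ ∑ _k ∈ Y, sc := Finset.sum_le_sum fun k _ => hsc k
    _ = Y.card * sc := by rw [Finset.sum_const, smul_eq_mul]

end Count

/-! ## §3  The column-sum letters of the pieces `C_X`, `C_loc` of (2.45) -/

section Pieces

variable {J S K : Type} [DecidableEq J] [Fintype S] [Fintype K] [DecidableEq K]
  (ldist : J → S → ℝ) (ρr : ℝ) (cubeOf : J → K) (cadj : K → K → Prop) (Cw : Walk J → S → S → ℝ)
  (inBlock : S → J → Prop) (cube : S → K)

omit [Fintype S] in
/-- **THE SUPPORT OF `C_X` READ THROUGH THE ROW (2.46)**: *"vanishes unless both arguments are in X"* (the row's first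
conjunct, `memX`) and the block geometry `hblk` (every site of the block `□_j` lies in a cube of the closure of the
cube of `j`) give `C_X(x₁,x₂) ≠ 0 ⇒ cube x₁ ∈ X ∧ cube x₂ ∈ X`. [cite: BalabanImbrieJaffe1988, (2.46) p.264] -/
theorem cube_mem_of_cX_ne_zero {c rek : ℝ}
    (h246 : BIJ88Sect2Statements.Ineq246 (fun X : Finset K => X.card) (memX inBlock cubeOf cadj)
      (cX ldist ρr cubeOf cadj Cw) c rek)
    (hblk : ∀ x j, inBlock x j → cube x ∈ closure cadj {cubeOf j}) {X : Finset K} {x₁ x₂ : S}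
    (h : cX ldist ρr cubeOf cadj Cw X x₁ x₂ ≠ 0) : cube x₁ ∈ X ∧ cube x₂ ∈ X := by
  have hmem : memX inBlock cubeOf cadj x₁ X ∧ memX inBlock cubeOf cadj x₂ X := by
    by_contra hno
    exact h (h246.1 X x₁ x₂ hno)
  obtain ⟨⟨j₁, hj₁, hX₁⟩, ⟨j₂, hj₂, hX₂⟩⟩ := hmem
  exact ⟨hX₁ (hblk x₁ j₁ hj₁), hX₂ (hblk x₂ j₂ hj₂)⟩

/-- **THE COLUMN-SUM LETTER OF `C_X`**: from the row (2.46) (entrywise `e^{−c·r(e_k)·|X|}` and the support clause)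
and `≤ s_c` sites per cube, `Σ_x|C_X(x,y)| ≤ e^{−c·r(e_k)·|X|}·(|X|·s_c)` — print's *"factor of e^{−cr(e_k)|X|}"*
in the `ℓ¹` currency of N4. [cite: BalabanImbrieJaffe1988, (2.46) p.264; §5.14 p.310] -/
theorem colsum_cX_le {c rek : ℝ}
    (h246 : BIJ88Sect2Statements.Ineq246 (fun X : Finset K => X.card) (memX inBlock cubeOf cadj)
      (cX ldist ρr cubeOf cadj Cw) c rek)
    (hblk : ∀ x j, inBlock x j → cube x ∈ closure cadj {cubeOf j}) {sc : ℕ}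
    (hsc : ∀ k, (univ.filter fun x => cube x = k).card ≤ sc) (X : Finset K) (y : S) :
    ∑ x, |cX ldist ρr cubeOf cadj Cw X x y| ≤ Real.exp (-c * rek * (X.card : ℕ)) * ((X.card * sc : ℕ) : ℝ) :=
  colsum_le_of_entry_support _ (Real.exp_pos _).le (h246.2 X) (fun _ => univ.filter fun x => cube x ∈ X)
    (fun _ _ h => Finset.mem_filter.mpr
      ⟨Finset.mem_univ _, (cube_mem_of_cX_ne_zero ldist ρr cubeOf cadj Cw inBlock cube h246 hblk h).1⟩)
    (fun _ => card_filter_cube_mem_le cube hsc X) y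

omit [Fintype K] in
/-- **THE COLUMN-SUM LETTER OF `C_loc`**: from an entrywise bound `E_loc` (*"bounded as in (2.41)"*), the finite range
(*"vanishes for |x₁ − x₂| > ½r(e_k)"*, read through `near ⊇ {site distance ≤ 2ρ}` as in W4d), a `near`-degree `≤ D`
and `≤ s_c` sites per cube: `Σ_x|C_loc(x,y)| ≤ E_loc·(D·s_c)`. [cite: BalabanImbrieJaffe1988, (2.43) p.264; §5.14 p.310] -/
theorem colsum_cLoc_le [Fintype K] {Eloc : ℝ} (hE0 : 0 ≤ Eloc) (hEloc : ∀ x y, |cLoc ldist ρr Cw x y| ≤ Eloc)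
    (sdist : S → S → ℝ) (htri : ∀ j x₁ x₂, sdist x₁ x₂ ≤ ldist j x₁ + ldist j x₂) (near : K → K → Prop)
    (hnear : ∀ x₁ x₂, sdist x₁ x₂ ≤ 2 * ρr → near (cube x₂) (cube x₁)) {D sc : ℕ}
    (hD : ∀ k, (univ.filter fun k' => near k k').card ≤ D)
    (hsc : ∀ k, (univ.filter fun x => cube x = k).card ≤ sc) (y : S) :
    ∑ x, |cLoc ldist ρr Cw x y| ≤ Eloc * ((D * sc : ℕ) : ℝ) := by
  refine colsum_le_of_entry_support _ hE0 hEloc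
    (fun y => univ.filter fun x => cube x ∈ univ.filter fun k' => near (cube y) k') (fun x y h => ?_)
    (fun y => ?_) y
  · exact Finset.mem_filter.mpr ⟨Finset.mem_univ _, Finset.mem_filter.mpr ⟨Finset.mem_univ _,
      cLoc_ne_zero_near ldist ρr Cw sdist htri cube near hnear h⟩⟩
  · exact (card_filter_cube_mem_le cube hsc _).trans (Nat.mul_le_mul_right _ (hD (cube y)))

end Pieces

/-! ## §4  Weights and clause letters for the family `none ↦ C_loc`, `some X ↦ C_X` -/

section Weights

/-- `e^{−a·m}·m ≤ e^{−a}` for `a ≥ 1` and `m ≥ 1` (`m ≤ e^{m−1}`; bookkeeping). [folklore] -/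
private theorem exp_neg_pow_mul_le {a : ℝ} (ha : 1 ≤ a) {m : ℕ} (hm : 1 ≤ m) :
    Real.exp (-a) ^ m * m ≤ Real.exp (-a) := by
  obtain ⟨n, rfl⟩ : ∃ n, m = n + 1 := ⟨m - 1, by omega⟩
  have h1 : Real.exp (-a) ^ n ≤ Real.exp (-1) ^ n :=
    pow_le_pow_left₀ (Real.exp_pos _).le (Real.exp_le_exp.mpr (by linarith)) n
  have h2 : Real.exp (-1) ^ n * ((n : ℝ) + 1) ≤ 1 := by
    rw [← Real.exp_nat_mul, mul_neg, mul_one]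
    calc Real.exp (-(n : ℝ)) * ((n : ℝ) + 1) ≤ Real.exp (-(n : ℝ)) * Real.exp n :=
          mul_le_mul_of_nonneg_left (Real.add_one_le_exp _) (Real.exp_pos _).le
      _ = 1 := by rw [← Real.exp_add, neg_add_cancel, Real.exp_zero]
  push_cast
  calc Real.exp (-a) ^ (n + 1) * ((n : ℝ) + 1) = Real.exp (-a) * (Real.exp (-a) ^ n * ((n : ℝ) + 1)) := by ring
    _ ≤ Real.exp (-a) * (Real.exp (-1) ^ n * ((n : ℝ) + 1)) :=
        mul_le_mul_of_nonneg_left (mul_le_mul_of_nonneg_right h1 (by positivity)) (Real.exp_pos _).le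
    _ ≤ Real.exp (-a) * 1 := mul_le_mul_of_nonneg_left h2 (Real.exp_pos _).le
    _ = Real.exp (-a) := mul_one _

variable {J S K : Type} [DecidableEq J] [Fintype S] [Fintype K] [DecidableEq K]

/-- **THE SEVEN CLAUSE INPUTS OF THE HEAD FOR PRINT'S SPLIT (2.45)** (`hB0`, `hρ`, `hB`, `hBf`, `hBzN`, `hloc`,
`hwalk` of `BIJ88WalkProductCutoffWeighted312.ineq312_remainder_bdry_prodCutoff_of_reach`, site product cutoffs).
Family `none ↦ C_loc`, `some X ↦ C_X` over the admissible regions `X` (a subtype `Adm`; in print the connected unions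
of `r(e_k)`-cubes), `trig = isSome`, `reg none = ∅`, `reg X = X`; weights `ρ_loc = 1`, `ρ_X = λ^{|X|}`,
`λ = e^{−c·r(e_k)/2}`; letters `B′_loc = E_loc·(D·s_c)·R₁K_w`, `B′_X = λ^{|X|}·(|X|·s_c)·R₁K_w`, `K_w = R_∞ + ‖f‖_∞ + 1`
(`B′_X·ρ_X = e^{−c·r(e_k)|X|}·|X|·s_c·R₁K_w`, the column-sum letter of §3).  Inputs: the typed row (2.46) for the
`C_X`, the entrywise letter `E_loc` and the finite range of `C_loc`, `≤ s_c` sites per cube, `near`-degree `≤ D`,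
directions with `‖u‖_∞ ≤ R_∞`, `Σ|u| ≤ R₁`, and the numbers: `4 ≤ c·r(e_k)`, `e^{−c·r(e_k)/4} ≤ θ`,
`E_loc·D·s_c·R₁K_w ≤ B_ℓ`, `e^{−c·r(e_k)/4}·s_c·R₁K_w ≤ θ_w` (print p. 260: `r(e_k) → ∞`).
[cite: BalabanImbrieJaffe1988, §5.14 p.310, p.312 (estimate preceding (5.14.5)); (2.43)-(2.46) p.264] -/
theorem split245_letters (ldist : J → S → ℝ) (ρr : ℝ) (cubeOf : J → K) (cadj : K → K → Prop)
    (Cw : Walk J → S → S → ℝ) (inBlock : S → J → Prop) (cube : S → K) (Adm : Finset K → Prop) {c rek : ℝ}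
    (h246 : BIJ88Sect2Statements.Ineq246 (fun X : Finset K => X.card) (memX inBlock cubeOf cadj)
      (cX ldist ρr cubeOf cadj Cw) c rek)
    (hblk : ∀ x j, inBlock x j → cube x ∈ closure cadj {cubeOf j})
    {Eloc : ℝ} (hE0 : 0 ≤ Eloc) (hEloc : ∀ x y, |cLoc ldist ρr Cw x y| ≤ Eloc)
    (sdist : S → S → ℝ) (htri : ∀ j x₁ x₂, sdist x₁ x₂ ≤ ldist j x₁ + ldist j x₂) (near : K → K → Prop)
    (hnear : ∀ x₁ x₂, sdist x₁ x₂ ≤ 2 * ρr → near (cube x₂) (cube x₁)) {D sc : ℕ}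
    (hD : ∀ k, (univ.filter fun k' => near k k').card ≤ D)
    (hsc : ∀ k, (univ.filter fun x => cube x = k).card ≤ sc)
    {B : Type} (Bs : Finset B) {y : B → S} (hy : Set.InjOn y Bs) (f : S → ℝ)
    {Dir : Set (S → ℝ)} {Rinf R1 : ℝ} (hRinf : 0 ≤ Rinf) (hR1 : 0 ≤ R1)
    (hDir : ∀ u ∈ Dir, ‖u‖ ≤ Rinf ∧ ∑ x, |u x| ≤ R1)
    {θ θw Bl : ℝ} (h4 : 4 ≤ c * rek) (hθrek : Real.exp (-(c * rek / 4)) ≤ θ)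
    (hBl' : Eloc * ((D * sc : ℕ) : ℝ) * (R1 * (Rinf + ‖f‖ + 1)) ≤ Bl)
    (hθw' : Real.exp (-(c * rek / 4)) * sc * (R1 * (Rinf + ‖f‖ + 1)) ≤ θw) :
    (∀ p : Option {X : Finset K // Adm X}, 0 ≤ (Option.elim p (Eloc * ((D * sc : ℕ) : ℝ) * (R1 * (Rinf + ‖f‖ + 1)))
        fun r => Real.exp (-(c * rek / 2)) ^ r.1.card * ((r.1.card * sc : ℕ) : ℝ) * (R1 * (Rinf + ‖f‖ + 1)) : ℝ)) ∧
    (∀ p : Option {X : Finset K // Adm X}, 0 ≤ (Option.elim p 1 fun r => Real.exp (-(c * rek / 2)) ^ r.1.card : ℝ)) ∧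
    (∀ p : Option {X : Finset K // Adm X}, ∀ u ∈ Dir, ∀ w ∈ Dir,
      |((Option.elim p (cLoc ldist ρr Cw) fun r => cX ldist ρr cubeOf cadj Cw r.1 : Matrix S S ℝ) *ᵥ u) ⬝ᵥ w|
        ≤ (Option.elim p (Eloc * ((D * sc : ℕ) : ℝ) * (R1 * (Rinf + ‖f‖ + 1)))
            fun r => Real.exp (-(c * rek / 2)) ^ r.1.card * ((r.1.card * sc : ℕ) : ℝ) * (R1 * (Rinf + ‖f‖ + 1)) : ℝ)
          * (Option.elim p 1 fun r => Real.exp (-(c * rek / 2)) ^ r.1.card : ℝ)) ∧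
    (∀ p : Option {X : Finset K // Adm X}, ∀ u ∈ Dir,
      |((Option.elim p (cLoc ldist ρr Cw) fun r => cX ldist ρr cubeOf cadj Cw r.1 : Matrix S S ℝ) *ᵥ u) ⬝ᵥ f|
        ≤ (Option.elim p (Eloc * ((D * sc : ℕ) : ℝ) * (R1 * (Rinf + ‖f‖ + 1)))
            fun r => Real.exp (-(c * rek / 2)) ^ r.1.card * ((r.1.card * sc : ℕ) : ℝ) * (R1 * (Rinf + ‖f‖ + 1)) : ℝ)
          * (Option.elim p 1 fun r => Real.exp (-(c * rek / 2)) ^ r.1.card : ℝ)) ∧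
    (∀ p : Option {X : Finset K // Adm X}, ∀ u ∈ Dir,
      (∑ b ∈ Bs, |(ContinuousLinearMap.proj (y b) : (S → ℝ) →L[ℝ] ℝ)
        ((Option.elim p (cLoc ldist ρr Cw) fun r => cX ldist ρr cubeOf cadj Cw r.1 : Matrix S S ℝ) *ᵥ u)|)
        ≤ (Option.elim p (Eloc * ((D * sc : ℕ) : ℝ) * (R1 * (Rinf + ‖f‖ + 1)))
            fun r => Real.exp (-(c * rek / 2)) ^ r.1.card * ((r.1.card * sc : ℕ) : ℝ) * (R1 * (Rinf + ‖f‖ + 1)) : ℝ)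
          * (Option.elim p 1 fun r => Real.exp (-(c * rek / 2)) ^ r.1.card : ℝ)) ∧
    (∀ p : Option {X : Finset K // Adm X}, Option.isSome p = false →
      (Option.elim p (Eloc * ((D * sc : ℕ) : ℝ) * (R1 * (Rinf + ‖f‖ + 1)))
          fun r => Real.exp (-(c * rek / 2)) ^ r.1.card * ((r.1.card * sc : ℕ) : ℝ) * (R1 * (Rinf + ‖f‖ + 1)) : ℝ)
        ≤ Bl ∧ (Option.elim p (∅ : Finset K) fun r => r.1) = ∅) ∧
    (∀ p : Option {X : Finset K // Adm X}, Option.isSome p = true →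
      (Option.elim p (Eloc * ((D * sc : ℕ) : ℝ) * (R1 * (Rinf + ‖f‖ + 1)))
          fun r => Real.exp (-(c * rek / 2)) ^ r.1.card * ((r.1.card * sc : ℕ) : ℝ) * (R1 * (Rinf + ‖f‖ + 1)) : ℝ)
        ≤ θw * θ ^ (Option.elim p (∅ : Finset K) fun r => r.1).card) := by
  set Kw : ℝ := R1 * (Rinf + ‖f‖ + 1) with hKw
  have hKw0 : 0 ≤ Kw := mul_nonneg hR1 (by linarith [norm_nonneg f])
  set lam : ℝ := Real.exp (-(c * rek / 2)) with hlam
  have hlam0 : 0 ≤ lam := (Real.exp_pos _).le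
  -- the column-sum letters of the pieces (§3)
  set C₁ : Option {X : Finset K // Adm X} → ℝ := fun p => Option.elim p (Eloc * ((D * sc : ℕ) : ℝ))
    fun r => Real.exp (-c * rek * (r.1.card : ℕ)) * ((r.1.card * sc : ℕ) : ℝ) with hC₁
  have hC0 : ∀ p, 0 ≤ C₁ p := by
    rintro (_ | r)
    · exact mul_nonneg hE0 (Nat.cast_nonneg _)
    · exact mul_nonneg (Real.exp_pos _).le (Nat.cast_nonneg _)
  have hC : ∀ p yy, ∑ x, |(Option.elim p (cLoc ldist ρr Cw) fun r => cX ldist ρr cubeOf cadj Cw r.1 :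
      Matrix S S ℝ) x yy| ≤ C₁ p := by
    rintro (_ | r) yy
    · exact colsum_cLoc_le ldist ρr Cw cube hE0 hEloc sdist htri near hnear hD hsc yy
    · exact colsum_cX_le ldist ρr cubeOf cadj Cw inBlock cube h246 hblk hsc r.1 yy
  obtain ⟨hB, hBf, hBzN⟩ := letters_of_colsum Bs hy hC0 hC f hRinf hR1 hDir
  -- `B′_p·ρ_p` is the column-sum letter times `K_w`
  have hsq : ∀ m : ℕ, lam ^ m * lam ^ m = Real.exp (-c * rek * (m : ℕ)) := fun m => by
    rw [hlam, ← mul_pow, ← Real.exp_add, ← Real.exp_nat_mul]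
    congr 1; ring
  have hprod : ∀ p : Option {X : Finset K // Adm X},
      (Option.elim p (Eloc * ((D * sc : ℕ) : ℝ) * Kw) fun r => lam ^ r.1.card * ((r.1.card * sc : ℕ) : ℝ) * Kw : ℝ)
        * (Option.elim p 1 fun r => lam ^ r.1.card : ℝ) = C₁ p * Kw := by
    rintro (_ | r)
    · simp only [Option.elim, hC₁, mul_one]
    · simp only [Option.elim, hC₁]
      rw [← hsq]; ring
  refine ⟨?_, ?_, fun p u hu w hw => ?_, fun p u hu => ?_, fun p u hu => ?_, ?_, ?_⟩
  · rintro (_ | r)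
    · exact mul_nonneg (mul_nonneg hE0 (Nat.cast_nonneg _)) hKw0
    · exact mul_nonneg (mul_nonneg (pow_nonneg hlam0 _) (Nat.cast_nonneg _)) hKw0
  · rintro (_ | r)
    · exact zero_le_one
    · exact pow_nonneg hlam0 _
  · rw [hprod]; exact hB p u hu w hw
  · rw [hprod]; exact hBf p u hu
  · rw [hprod]; exact hBzN p u hu
  · rintro (_ | r) hp
    · exact ⟨hBl', rfl⟩
    · simp at hp
  · rintro (_ | r) hp
    · simp at hp
    · simp only [Option.elim]
      -- `B′_X = λ^m·(m·s_c)·K_w ≤ θ_w·θ^m`, `m = |X|`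
      set m : ℕ := r.1.card with hm
      have ha : 1 ≤ c * rek / 4 := by linarith
      have hθ0 : 0 ≤ θ := (Real.exp_pos _).le.trans hθrek
      have hθw0 : 0 ≤ θw := le_trans (mul_nonneg (mul_nonneg (Real.exp_pos _).le (Nat.cast_nonneg _)) hKw0) hθw'
      have hlam2 : lam = Real.exp (-(c * rek / 4)) * Real.exp (-(c * rek / 4)) := by
        rw [hlam, ← Real.exp_add]; congr 1; ring
      rcases Nat.eq_zero_or_pos m with hm0 | hmpos
      · rw [hm0]; simp only [pow_zero, Nat.cast_zero, zero_mul, mul_zero, mul_one]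
        exact hθw0
      · have hq : Real.exp (-(c * rek / 4)) ^ m ≤ θ ^ m := pow_le_pow_left₀ (Real.exp_pos _).le hθrek m
        have hkey : Real.exp (-(c * rek / 4)) ^ m * (m : ℝ) ≤ Real.exp (-(c * rek / 4)) :=
          exp_neg_pow_mul_le ha hmpos
        calc lam ^ m * ((m * sc : ℕ) : ℝ) * Kw
            = θw * 0 + (Real.exp (-(c * rek / 4)) ^ m * (m : ℝ)) * (sc * Kw) * Real.exp (-(c * rek / 4)) ^ m := by
              rw [hlam2, mul_pow]; push_cast; ring
          _ ≤ θw * 0 + Real.exp (-(c * rek / 4)) * (sc * Kw) * θ ^ m := by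
              refine add_le_add le_rfl (mul_le_mul (mul_le_mul_of_nonneg_right hkey (by positivity)) hq
                (pow_nonneg (Real.exp_pos _).le _) ?_)
              exact mul_nonneg (Real.exp_pos _).le (by positivity)
          _ ≤ θw * 0 + θw * θ ^ m := by
              refine add_le_add le_rfl (mul_le_mul_of_nonneg_right ?_ (pow_nonneg hθ0 _))
              calc Real.exp (-(c * rek / 4)) * (sc * Kw) = Real.exp (-(c * rek / 4)) * sc * Kw := by ring
                _ ≤ θw := hθw'
          _ = θw * θ ^ m := by ring

end Weights

end Literature.MathematicalPhysics.QuantumFieldTheory.BalabanImbrieJaffe1984to88.BIJ88WalkSplit245Letters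

end
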